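import Summits.CriticalPhenomena.Ising3DConformalLimit.Theorems.EnergyNotSigmaSquaredGapForcesFarMergingReduction

/-!
# Pinched transparency — the EXACT consumption of the scale iteration, a strictly weaker stub 4′
# (negative-side analysis of crux `GapForcesFarMerging`, item stmt-CriticalPhenomena-4468; standing
# disprover, generation 4)

The line `rp-unpinch-single-passage` is closed modulo `QuasiMultiplicativeShape cc2 (criticalCorr 3 4)`
(`gapForcesFarMerging_of_quasiMultiplicative`) and even modulo its dyadic weakening
(`gapForcesFarMerging_of_quasiMultiplicativeDyadic`). Reading the dyadic iteration
(`scaleIteration_soft_dyadic`) line by line shows that quasi-multiplicativity is invoked ONLY inside the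
`¬ FarMerging` branch, at pairs of scales `(2^i, 2^{i+ℓ})` where the opened configuration
`Th(2^ℓ)·2^i = (0, dn 2^{i+ℓ}, 2^i e₂, up 2^{i+ℓ})` does NOT merge (Aizenman's `U₄ > -½⟨σσ⟩⟨σσ⟩`), and
that the opened avoidance factor `𝒜(2^i e₂; 2^{i+ℓ}) > 1/2` is then discarded. What is consumed is:

* `PinchedTransparencyShape S F` ("transparent octaves are free for the pinched pair"): for every rate
  `η < 1` and all long passages `ℓ`, a constant `c(ℓ) ≥ η^ℓ` such that for all large `i`,
  IF the opened strands at separation `2^i` do not merge by scale `2^{i+ℓ}`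
  THEN `c(ℓ) · 𝒜(e₂; 2^i) ≤ 𝒜(e₂; 2^{i+ℓ})` — the adjacent-pinch avoidance loses at most `2^{o(ℓ)}`
  over `ℓ` octaves in which far-apart strands pass freely.

Results (all kernel-checked, axioms `propext, Classical.choice, Quot.sound`):

* `transparency_of_qmDyadic`: `QuasiMultiplicativeDyadicShape → PinchedTransparencyShape` over the
  package (so `QuasiMultiplicativeShape →` it as well): PT is WEAKER than both registered forms.
* `scaleIteration_soft_transparent`: `SinglePinchLawShape → SinglePinchPositiveShape →
  PinchedTransparencyShape → FarMergingShape` over the soft package — stub 5 runs on PT alone.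
* `gapForcesFarMerging_of_transparency : PinchedTransparencyShape cc2 (criticalCorr 3 4) →
  GapForcesFarMerging` — with the landed stubs 1–3 the crux is closed modulo PT; the candidate
  replacement stub 4′ is spelled out over tree vocabulary in `pinchedTransparencyShape_criticalCorr_iff`.
* `not_pinchedTransparency_A'`, `pinchedTransparency_false_without_model`: PT is NOT SOFT (family A′ of
  `Negative.LineFamily` has package + GAP + isosceles RP + envelope + single-pinch law + strict
  positivity and violates PT) — the model must still enter, but only in the counterfactual
  "transparent" regime where the far strands do not merge.
* (in the sequel `Negative/SlowPinch.lean`, split off for the 400-line cap:)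
  `SlowPinchUnderTransparencyShape` (stub 4″, sequence form of the residual): transparency of the far
  field on the thin dyadic shapes ⟹ the pinch sequence `𝒜(e₂;2^i)` decays slower than every `η^i`.
  `slowPinch_of_transparency : SPP → PT → ST`, `farMerging_of_slowPinch : SPL → ST → FarMerging`
  (no positivity, no block iteration), `gapForcesFarMerging_of_slowPinch : ST cc2 (criticalCorr 3 4) →
  GapForcesFarMerging`, `slowPinch_false_without_model` (A′). Chain of sufficient statements:
  `QM ⟹ QMdyadic ⟹ PT ⟹(SPP) ST ⟹(SPL) FarMerging`, all four not soft; the first two over-shoot (family E).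
* `ThinFarMergingShape` / `EventualMergingShape`: the conclusion in the form the line produces, and
  the expected interacting behaviour. `slowPinch_iff_thinFarMerging : SPL → (ST ↔ ThinFM)` — the
  taxonomy BOTTOMS OUT at the conclusion: ST is the residual crux `SPL ⟹ FM_thin` in contrapositive,
  sequence form, nothing more; `pinchedTransparency_of_eventualMerging : EM → PT` — in a world with
  the expected merging PT is vacuous, so its whole content is the counterfactual transparent branch
  (whereas QM's truth in the interacting regime encodes exponent identities `κ_s ≍ s^{ζ}` for the
  lattice three-point coefficients — strictly harder than the crux needs, and unnecessary: family E).
* Why PT is the better-posed stub: the companion file `Negative/FarMergingWithoutQM.lean` (family E)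
  shows that `QuasiMultiplicative(Dyadic)Shape` FAILS in a soft model that has every line input AND far
  merging on every shape — uniform quasi-multiplicativity asserts more than the crux needs, and its
  failure mode (`𝒜(e₂;m) ≪ 𝒜(e₂;s)𝒜(se₂;m)`) is compatible with, indeed typical of, STRONG merging;
  PT holds in that model (vacuously) and is violated only together with far merging's failure.

References: Lawler 1991, ch. 3–5 (quasi-multiplicativity / separation lemmas, the model statements)
[Lawler1991]; Aizenman 1982 (`U₄ = -2⟨σσ⟩⟨σσ⟩·P[merge]`) [AizenmanCMP1982]; Aizenman–Duminil-Copin 2021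
[AizenmanDuminilCopinAnnals2021]; Fröhlich–Israel–Lieb–Simon 1978 (RP) [FILS1978].
-/

noncomputable section

namespace Summit.CriticalPhenomena.Ising3DConformalLimit.Theorems.GapForcesFarMerging.Negative

open Literature.Probability.LatticeModels
open Summit.CriticalPhenomena.Ising3DConformalLimit.Theses.EnergyNotSigmaSquared
open Summit.CriticalPhenomena.Ising3DConformalLimit.EnergyNotSigmaSquaredGapForcesFarMerging
  (rpUnpinchIsoShape_criticalCorr singlePinchPositiveShape_criticalCorr singlePinchLawShape_of_gap)
open Summit.CriticalPhenomena.Ising3DConformalLimit.EnergyNotSigmaSquaredGapForcesFarMerging.ScaleIteration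
  (NparS_pos half_lt_avoidS_of_not_merge avoidS_dyadic_le exists_good_scale)

section shapes

variable {S : Site 3 → Site 3 → ℝ} {T : Site 3 → ℝ} {F : (Fin 4 → Site 3) → ℝ}

/-- The avoidance functional is non-negative (GKS II). [folklore] -/
theorem avoidS_nonneg_soft (hP : SoftPackageNoBubble S T F) (b : Site 3) (m : ℕ) :
    0 ≤ avoidS S F b m := by
  unfold avoidS TS pairCovS
  refine div_nonneg ?_ (NparS_pos hP b m).le
  have h := hP.griffiths ![0, b, up m, dn m]
  simp only [Matrix.cons_val_zero, Matrix.cons_val_one, Matrix.cons_val] at h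
  linarith

/-- **Pinched transparency** (stub 4′, the exact consumption of the scale iteration): for every rate
`η ∈ (0,1)` and all large passage lengths `ℓ` there are `c(ℓ) ≥ η^ℓ` and `i₁` such that for `i ≥ i₁`:
IF the opened configuration `(0, dn 2^{i+ℓ}, 2^i e₂, up 2^{i+ℓ})` does not merge in Aizenman's sense
(`U₄ > -½·S(0,dn)S(2^i e₂,up)`), THEN `c(ℓ)·𝒜(e₂;2^i) ≤ 𝒜(e₂;2^{i+ℓ})`. [folklore] -/
def PinchedTransparencyShape (S : Site 3 → Site 3 → ℝ) (F : (Fin 4 → Site 3) → ℝ) : Prop :=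
  ∀ η : ℝ, 0 < η → η < 1 → ∃ ℓ₀ : ℕ, ∀ ℓ : ℕ, ℓ₀ ≤ ℓ → ∃ c : ℝ, η ^ ℓ ≤ c ∧ ∃ i₁ : ℕ, ∀ i : ℕ, i₁ ≤ i →
    -(1 / 2 * (S 0 (dn (2 ^ (i + ℓ))) * S (src (2 ^ i)) (up (2 ^ (i + ℓ))))) <
        F ![0, dn (2 ^ (i + ℓ)), src (2 ^ i), up (2 ^ (i + ℓ))] -
          (S 0 (dn (2 ^ (i + ℓ))) * S (src (2 ^ i)) (up (2 ^ (i + ℓ))) +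
            S 0 (src (2 ^ i)) * S (dn (2 ^ (i + ℓ))) (up (2 ^ (i + ℓ))) +
            S 0 (up (2 ^ (i + ℓ))) * S (dn (2 ^ (i + ℓ))) (src (2 ^ i))) →
      c * avoidS S F e₂ (2 ^ i) ≤ avoidS S F e₂ (2 ^ (i + ℓ))

/-- **Dyadic quasi-multiplicativity implies pinched transparency** (over the package: in a
non-merging octave block the discarded factor is `𝒜(2^i e₂; 2^{i+ℓ}) > 1/2`,
`half_lt_avoidS_of_not_merge`; the factor `1/2` is absorbed by raising the rate). [folklore] -/
theorem transparency_of_qmDyadic (hP : SoftPackageNoBubble S T F)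
    (h : QuasiMultiplicativeDyadicShape S F) : PinchedTransparencyShape S F := by
  intro η hη0 hη1
  -- raise the rate: η' = (1+η)/2, and 2 η^ℓ ≤ η'^ℓ for large ℓ
  set η' : ℝ := (1 + η) / 2 with hη'
  have hη'0 : 0 < η' := by rw [hη']; linarith
  have hη'1 : η' < 1 := by rw [hη']; linarith
  have hηη' : η < η' := by rw [hη']; linarith
  have hq0 : 0 < η / η' := div_pos hη0 hη'0
  have hq1 : η / η' < 1 := (div_lt_one hη'0).2 hηη'
  obtain ⟨ℓ₂, hℓ₂⟩ := exists_pow_lt_of_lt_one (show (0 : ℝ) < 1 / 2 by norm_num) hq1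
  obtain ⟨ℓ₀, hℓ₀⟩ := h η' hη'0 hη'1
  refine ⟨max ℓ₀ ℓ₂, fun ℓ hℓ => ?_⟩
  obtain ⟨c, hc, i₁, hqm⟩ := hℓ₀ ℓ ((le_max_left _ _).trans hℓ)
  have hcpos : 0 < c := lt_of_lt_of_le (pow_pos hη'0 ℓ) hc
  refine ⟨c / 2, ?_, i₁, fun i hi hL => ?_⟩
  · -- η^ℓ = (η/η')^ℓ η'^ℓ ≤ (1/2) η'^ℓ ≤ c/2
    have h1 : (η / η') ^ ℓ ≤ 1 / 2 :=
      ((pow_le_pow_of_le_one hq0.le hq1.le ((le_max_right _ _).trans hℓ)).trans hℓ₂.le)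
    have h2 : η ^ ℓ = (η / η') ^ ℓ * η' ^ ℓ := by
      rw [← mul_pow, div_mul_cancel₀ η hη'0.ne']
    rw [h2]
    have h3 : 0 ≤ η' ^ ℓ := (pow_pos hη'0 ℓ).le
    nlinarith [mul_le_mul_of_nonneg_right h1 h3]
  · have hav := half_lt_avoidS_of_not_merge hP hL
    have hq := hqm i hi
    have hA0 : 0 ≤ avoidS S F e₂ (2 ^ i) := avoidS_nonneg_soft hP _ _
    have : c / 2 * avoidS S F e₂ (2 ^ i) ≤
        c * avoidS S F e₂ (2 ^ i) * avoidS S F (src (2 ^ i)) (2 ^ (i + ℓ)) := by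
      have := mul_nonneg hcpos.le hA0
      nlinarith
    exact this.trans hq

/-- Uniform quasi-multiplicativity implies pinched transparency. [folklore] -/
theorem transparency_of_qm (hP : SoftPackageNoBubble S T F) (h : QuasiMultiplicativeShape S F) :
    PinchedTransparencyShape S F :=
  transparency_of_qmDyadic hP (qmDyadic_of_qm h)

/-- **Stub 5 runs on pinched transparency alone.** Over any triple with the soft package:
single-pinch law + strict single-pinch positivity + pinched transparency ⟹ far merging (along a thin
shape `Th(2^ℓ)`, by contradiction with `c = 1/2`; the proof is the dyadic iteration with the
quasi-multiplicativity call replaced by the conditional one — its hypothesis is exactly the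
non-merging statement available in the `¬ FarMerging` branch). [folklore] -/
theorem scaleIteration_soft_transparent (hP : SoftPackageNoBubble S T F) :
    SinglePinchLawShape S T F → SinglePinchPositiveShape S F → PinchedTransparencyShape S F →
      FarMergingShape S F := by
  rintro ⟨κ', C, hκ', hspl⟩ hSPP hPT
  by_contra hFM
  -- the avoidance sequence along dyadic scales and its positivity
  set A : ℕ → ℝ := fun i => avoidS S F e₂ (2 ^ i) with hA
  have hApos : ∀ i, 0 < A i := fun i =>
    div_pos (hSPP (2 ^ i) Nat.one_le_two_pow) (NparS_pos hP _ _)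
  -- r = 2^{-κ'} ∈ (0,1), η = √r; choose ℓ ≥ 1 with η^ℓ ≤ 1/2 and a constant c ≥ η^ℓ along (2^i, 2^{i+ℓ})
  set r : ℝ := (2 : ℝ) ^ (-κ') with hr
  have hr0 : 0 < r := Real.rpow_pos_of_pos two_pos _
  have hr1 : r < 1 := Real.rpow_lt_one_of_one_lt_of_neg one_lt_two (by linarith)
  set η : ℝ := Real.sqrt r with hη
  have hη0 : 0 < η := Real.sqrt_pos.2 hr0
  have hη1 : η < 1 := by rw [hη, ← Real.sqrt_one]; exact Real.sqrt_lt_sqrt hr0.le hr1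
  have hηr : η ^ 2 = r := Real.sq_sqrt hr0.le
  obtain ⟨ℓ₀, hℓ₀⟩ := hPT η hη0 hη1
  obtain ⟨ℓ₁, hℓ₁⟩ := exists_pow_lt_of_lt_one (show (0 : ℝ) < 1 / 2 by norm_num) hη1
  obtain ⟨ℓ, hℓ1, hℓℓ₀, hℓℓ₁⟩ : ∃ ℓ : ℕ, 1 ≤ ℓ ∧ ℓ₀ ≤ ℓ ∧ ℓ₁ ≤ ℓ :=
    ⟨max (max ℓ₀ ℓ₁) 1, le_max_right _ _, (le_max_left _ _).trans (le_max_left _ _),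
      (le_max_right _ _).trans (le_max_left _ _)⟩
  obtain ⟨c, hcη, i₁, hpt⟩ := hℓ₀ ℓ hℓℓ₀
  have hηℓ : 0 < η ^ ℓ := pow_pos hη0 ℓ
  have hc : 0 < c := lt_of_lt_of_le hηℓ hcη
  have hrℓ : r ^ ℓ ≤ c / 2 := by
    have h1 : η ^ ℓ ≤ 1 / 2 := (pow_le_pow_of_le_one hη0.le hη1.le hℓℓ₁).trans hℓ₁.le
    calc r ^ ℓ = η ^ ℓ * η ^ ℓ := by rw [← hηr, ← pow_mul, mul_comm 2 ℓ, pow_mul, sq]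
      _ ≤ (1 / 2) * c := mul_le_mul h1 hcη hηℓ.le (by norm_num)
      _ = c / 2 := by ring
  -- no far merging along the thin shape Th(2^ℓ) with c = 1/2
  have hFM' := hFM
  unfold FarMergingShape at hFM'
  push Not at hFM'
  obtain ⟨L₀, hL₀⟩ := hFM' (1 / 2) (by norm_num) (Th (2 ^ ℓ)) (Th_injective Nat.one_le_two_pow)
  set I₀ : ℕ := max L₀ i₁ with hI₀
  -- one step of the iteration: the conditional call, fed with the non-merging of the branch
  have step : ∀ i, I₀ ≤ i → c * A i ≤ A (i + ℓ) := by
    intro i hi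
    have hiL : L₀ ≤ i := (le_max_left _ _).trans hi
    have hi₁ : i₁ ≤ i := (le_max_right _ _).trans hi
    have hL := hL₀ (2 ^ i) (hiL.trans Nat.lt_two_pow_self.le)
    obtain ⟨h0, h1, h2, h3⟩ := smul_Th_pts (2 ^ ℓ) (2 ^ i)
    rw [smul_Th, h0, h1, h2, h3] at hL
    rw [show 2 ^ ℓ * 2 ^ i = 2 ^ (i + ℓ) by rw [← pow_add, add_comm]] at hL
    exact hpt i hi₁ hL
  -- the iteration
  have iter : ∀ i, I₀ ≤ i → ∀ k : ℕ, c ^ k * A i ≤ A (i + k * ℓ) := by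
    intro i hi k
    induction k with
    | zero => simp
    | succ k ih =>
      have hs := step (i + k * ℓ) (by omega)
      rw [show i + (k + 1) * ℓ = i + k * ℓ + ℓ by ring]
      calc c ^ (k + 1) * A i = c * (c ^ k * A i) := by ring
        _ ≤ c * A (i + k * ℓ) := mul_le_mul_of_nonneg_left ih hc.le
        _ ≤ A (i + k * ℓ + ℓ) := hs
  -- a uniform positive floor over the ℓ starting scales
  obtain ⟨j₀, hj₀, hmin⟩ := Finset.exists_min_image (Finset.range ℓ) (fun j => A (I₀ + j))
    ⟨0, Finset.mem_range.2 (by omega)⟩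
  set a₀ := A (I₀ + j₀) with ha₀
  have ha₀pos : 0 < a₀ := hApos _
  have lower : ∀ i, I₀ ≤ i → c ^ ((i - I₀) / ℓ) * a₀ ≤ A i := by
    intro i hi
    have hdecomp : i = I₀ + (i - I₀) % ℓ + (i - I₀) / ℓ * ℓ := by
      have := Nat.mod_add_div (i - I₀) ℓ
      rw [mul_comm] ; omega
    have hjlt : (i - I₀) % ℓ < ℓ := Nat.mod_lt _ (by omega)
    have h1 := iter (I₀ + (i - I₀) % ℓ) (by omega) ((i - I₀) / ℓ)
    rw [← hdecomp] at h1
    have h2 : a₀ ≤ A (I₀ + (i - I₀) % ℓ) := hmin _ (Finset.mem_range.2 hjlt)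
    calc c ^ ((i - I₀) / ℓ) * a₀ ≤ c ^ ((i - I₀) / ℓ) * A (I₀ + (i - I₀) % ℓ) :=
          mul_le_mul_of_nonneg_left h2 (by positivity)
      _ ≤ A i := h1
  -- choose the depth k₀ and a good scale beyond it
  set Cp : ℝ := max C 0 with hCp
  have hCp0 : 0 ≤ Cp := le_max_right _ _
  obtain ⟨k₀, hk₀⟩ := exists_pow_lt_of_lt_one (show 0 < a₀ / (1024 * Cp + 1) by positivity)
    (show (1 / 2 : ℝ) < 1 by norm_num)
  obtain ⟨i, hiN, hgood⟩ := exists_good_scale hP (I₀ + k₀ * ℓ)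
  have hiL : I₀ ≤ i := by omega
  set k : ℕ := (i - I₀) / ℓ with hk
  have hk₀k : k₀ ≤ k := (Nat.le_div_iff_mul_le (by omega)).2 (by omega)
  have hkℓ : k * ℓ ≤ i + 1 := (Nat.div_mul_le_self (i - I₀) ℓ).trans (by omega)
  -- upper bound at the good scale
  have hup : A i ≤ 1024 * Cp * r ^ (i + 1) := by
    have h := avoidS_dyadic_le hP hspl i
    have hb3 : 0 < S 0 (Pi.single 0 ((2 ^ (i + 3) : ℕ) : ℤ)) := hP.pos _ _
    have hb1 : 0 ≤ S 0 (Pi.single 0 ((2 ^ (i + 1) : ℕ) : ℤ)) := (hP.pos _ _).le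
    have hratio : S 0 (Pi.single 0 ((2 ^ (i + 1) : ℕ) : ℤ)) ^ 2 /
        S 0 (Pi.single 0 ((2 ^ (i + 3) : ℕ) : ℤ)) ^ 2 ≤ 1024 := by
      rw [div_le_iff₀ (by positivity)]
      nlinarith [mul_le_mul hgood hgood hb1 (by positivity)]
    calc A i ≤ Cp * r ^ (i + 1) * S 0 (Pi.single 0 ((2 ^ (i + 1) : ℕ) : ℤ)) ^ 2 /
          S 0 (Pi.single 0 ((2 ^ (i + 3) : ℕ) : ℤ)) ^ 2 := h
      _ = Cp * r ^ (i + 1) * (S 0 (Pi.single 0 ((2 ^ (i + 1) : ℕ) : ℤ)) ^ 2 /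
          S 0 (Pi.single 0 ((2 ^ (i + 3) : ℕ) : ℤ)) ^ 2) := by ring
      _ ≤ Cp * r ^ (i + 1) * 1024 := mul_le_mul_of_nonneg_left hratio (by positivity)
      _ = 1024 * Cp * r ^ (i + 1) := by ring
  -- r^{i+1} ≤ (r^ℓ)^k ≤ (c/2)^k = c^k (1/2)^k
  have hrk : r ^ (i + 1) ≤ c ^ k * (1 / 2) ^ k := by
    calc r ^ (i + 1) ≤ r ^ (k * ℓ) := pow_le_pow_of_le_one hr0.le hr1.le hkℓ
      _ = (r ^ ℓ) ^ k := by rw [mul_comm, pow_mul]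
      _ ≤ (c / 2) ^ k := pow_le_pow_left₀ (by positivity) hrℓ k
      _ = c ^ k * (1 / 2) ^ k := by rw [← mul_pow]; ring
  -- combine
  have hck : 0 < c ^ k := by positivity
  have hmain : c ^ k * a₀ ≤ c ^ k * (1024 * Cp * (1 / 2) ^ k) := by
    calc c ^ k * a₀ ≤ A i := lower i hiL
      _ ≤ 1024 * Cp * r ^ (i + 1) := hup
      _ ≤ 1024 * Cp * (c ^ k * (1 / 2) ^ k) := mul_le_mul_of_nonneg_left hrk (by positivity)
      _ = c ^ k * (1024 * Cp * (1 / 2) ^ k) := by ring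
  have h1 : a₀ ≤ 1024 * Cp * (1 / 2) ^ k := le_of_mul_le_mul_left hmain hck
  have h2 : (1 / 2 : ℝ) ^ k ≤ (1 / 2) ^ k₀ := pow_le_pow_of_le_one (by norm_num) (by norm_num) hk₀k
  have h3 : (1 / 2 : ℝ) ^ k₀ * (1024 * Cp + 1) < a₀ := by
    rwa [lt_div_iff₀ (by positivity)] at hk₀
  nlinarith [mul_le_mul_of_nonneg_left h2 (by positivity : (0 : ℝ) ≤ 1024 * Cp),
    pow_pos (show (0 : ℝ) < 1 / 2 by norm_num) k₀]

/-- The registered stub 5 factors through pinched transparency. [folklore] -/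
theorem scaleIteration_soft_dyadic' (hP : SoftPackageNoBubble S T F) :
    SinglePinchLawShape S T F → SinglePinchPositiveShape S F → QuasiMultiplicativeDyadicShape S F →
      FarMergingShape S F :=
  fun h1 h2 h3 => scaleIteration_soft_transparent hP h1 h2 (transparency_of_qmDyadic hP h3)


end shapes

/-! ## Pinched transparency is not soft: family A′ -/

section noGo

/-- **A′ violates pinched transparency** — by the transparent iteration itself, since A′ has the
single-pinch law, strict positivity and no far merging (directly: on `Th(2^ℓ)·2^i` family A′ does not
merge, `θ_{A′} → 0`, while `𝒜_{A′}(e₂;2^{i+ℓ})/𝒜_{A′}(e₂;2^i) = (q_{2^{i+ℓ}}/q_{2^i})² ≈ 4^{-ℓ}`). [folklore] -/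
theorem not_pinchedTransparency_A' : ¬ PinchedTransparencyShape S₀ FA' := fun h =>
  not_farMergingShape_A'
    (scaleIteration_soft_transparent softPackageNoBubble_A' singlePinchLawShape_A'
      singlePinchPositiveShape_A' h)

/-- **Stub 4′ is not soft**: no argument from the 22-field soft package + GAP + the isosceles RP
minors + the un-pinched envelope + the single-pinch law + strict single-pinch positivity proves
pinched transparency. The model enters — but only in the transparent (non-merging) regime. [folklore] -/
theorem pinchedTransparency_false_without_model :
    ¬ ∀ (S : Site 3 → Site 3 → ℝ) (T : Site 3 → ℝ) (F : (Fin 4 → Site 3) → ℝ),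
      SoftPackage S T F → GapShape S T F → RPUnpinchIsoShape S F → UnpinchedEnvelopeShape S T F →
        SinglePinchLawShape S T F → SinglePinchPositiveShape S F → PinchedTransparencyShape S F :=
  fun h => not_pinchedTransparency_A' (h S₀ T₀ FA' softPackage_A' gapShape_A'
    rpUnpinchIsoShape_A' unpinchedEnvelopeShape_A' singlePinchLawShape_A' singlePinchPositiveShape_A')

end noGo

/-! ## The Ising instance: the crux is closed modulo pinched transparency -/

section ising

/-- Pinched transparency at the critical correlators, spelled out over tree vocabulary (the text of
the candidate stub 4′ for the lead; `Iff.rfl`). With `up m = (2m,m,0)`, `dn m = (2m,-m,0)`,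
`𝒜(e₂;m) = ⟨σ₀σ_{e₂} ; σ_{up m}σ_{dn m}⟩/(⟨σ₀σ_{dn m}⟩⟨σ_{e₂}σ_{up m}⟩)`. [folklore] -/
theorem pinchedTransparencyShape_criticalCorr_iff :
    PinchedTransparencyShape cc2 (criticalCorr 3 4) ↔
      ∀ η : ℝ, 0 < η → η < 1 → ∃ ℓ₀ : ℕ, ∀ ℓ : ℕ, ℓ₀ ≤ ℓ → ∃ c : ℝ, η ^ ℓ ≤ c ∧ ∃ i₁ : ℕ, ∀ i : ℕ, i₁ ≤ i →
        -(1 / 2 * (criticalCorr 3 2 ![0, dn (2 ^ (i + ℓ))] * criticalCorr 3 2 ![src (2 ^ i), up (2 ^ (i + ℓ))])) <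
            criticalCorr 3 4 ![0, dn (2 ^ (i + ℓ)), src (2 ^ i), up (2 ^ (i + ℓ))] -
              (criticalCorr 3 2 ![0, dn (2 ^ (i + ℓ))] * criticalCorr 3 2 ![src (2 ^ i), up (2 ^ (i + ℓ))] +
                criticalCorr 3 2 ![0, src (2 ^ i)] * criticalCorr 3 2 ![dn (2 ^ (i + ℓ)), up (2 ^ (i + ℓ))] +
                criticalCorr 3 2 ![0, up (2 ^ (i + ℓ))] * criticalCorr 3 2 ![dn (2 ^ (i + ℓ)), src (2 ^ i)]) →
          c * ((criticalCorr 3 4 ![0, e₂, up (2 ^ i), dn (2 ^ i)] -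
                  criticalCorr 3 2 ![0, e₂] * criticalCorr 3 2 ![up (2 ^ i), dn (2 ^ i)]) /
                (criticalCorr 3 2 ![0, dn (2 ^ i)] * criticalCorr 3 2 ![e₂, up (2 ^ i)])) ≤
            (criticalCorr 3 4 ![0, e₂, up (2 ^ (i + ℓ)), dn (2 ^ (i + ℓ))] -
                criticalCorr 3 2 ![0, e₂] * criticalCorr 3 2 ![up (2 ^ (i + ℓ)), dn (2 ^ (i + ℓ))]) /
              (criticalCorr 3 2 ![0, dn (2 ^ (i + ℓ))] * criticalCorr 3 2 ![e₂, up (2 ^ (i + ℓ))]) :=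
  Iff.rfl

/-- The transparent scale iteration at the critical correlators of `ℤ³`. [folklore] -/
theorem scaleIteration_transparent_criticalCorr :
    SinglePinchLawShape cc2 (criticalTwoPoint 3) (criticalCorr 3 4) →
      SinglePinchPositiveShape cc2 (criticalCorr 3 4) →
        PinchedTransparencyShape cc2 (criticalCorr 3 4) → FarMergingShape cc2 (criticalCorr 3 4) :=
  scaleIteration_soft_transparent softPackageNoBubble_criticalCorr

/-- **The crux reduces to pinched transparency alone**: with stubs 1 (isosceles RP minors), 2
(envelope, inside `singlePinchLawShape_of_gap`) and 3 (strict positivity) landed,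
`PinchedTransparencyShape cc2 (criticalCorr 3 4) → GapForcesFarMerging`. [folklore] -/
theorem gapForcesFarMerging_of_transparency
    (h4 : PinchedTransparencyShape cc2 (criticalCorr 3 4)) : GapForcesFarMerging := by
  rw [crux_iff_shapes]
  intro hGAP
  exact scaleIteration_transparent_criticalCorr (singlePinchLawShape_of_gap hGAP)
    singlePinchPositiveShape_criticalCorr h4

end ising

end Summit.CriticalPhenomena.Ising3DConformalLimit.Theorems.GapForcesFarMerging.Negative

end
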